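/-
Copyright: the b2b-balaban cell (near-miss cell 7), T⁴-continuum fan-out, lineage t4-ne7b-p3 (node U5c LARGE-DEVIATION
member P3).  Released under the licence of the surrounding project.
-/
import Summits.QuantumFields.BalabanUV.T4Continuum.Support.SpaceTimeAssemblyT
import Summits.QuantumFields.BalabanUV.T4Continuum.Support.SpaceTimeRealisedFlow

/-!
# Space-time Peierls ∕ Cramér route for NE7b — THE JUNCTION ON THE TAGGED LABEL, PACKAGED: on the COUNT carrier the
# lineage readings hold for EVERY realised family with reading (iv‴) = `Realises ∧ PendingAt` — NOTHING ELSE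
# (no `TypeNodup`, no `RenewAtReach`), and the flow END's binder is inhabited from realised data + readings + typed flow
# facts only

Summits-side support leaf of the T⁴-continuum cell (rung (B)+1 on a FINITE torus only; NOT infinite volume, NOT the
mass gap, NOT the Clay statement; NOT a proof of the spine estimate NE7b).  Lineage `t4-ne7b-p3` (generation 3), node
U5c, skeleton `t4/skeletons/NE7b-t4-ne7b-p3.md` §14 (the TAGGED road).  [folklore] assembly over this lineage's
`SpaceTimeRealisedLin` ∕ `SpaceTimeRealisedFlow` (`RLin`, levels from the flow), `SpaceTimeRelabel` (invariance under
`gmap`), `SpaceTimeTagged` (`toGenT`, timing from the geometry), `SpaceTimeJunctionT` (`pieceOfT`,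
`skelOK_of_realisesT`), `SpaceTimeAssemblyT` (`LineageReadingsT`, `RunReadingsFlowT`), `SpaceTimeOccTorus` ∕
`SpaceTimeSeparation`, and the COUNT swarm's `HistoryRealise` — all BY NAME; nothing printed is asserted; no `[cite:]`.

WHAT.
* §1 `RLin.toLinDataT` — the lineage data over the labels `Λ × (ℕ × PEv)` (genealogy of `λ` = push-forward of the
  TAGGED label `toGenT 0 (P λ)`, pieces `pieceOfT L s 0 (P λ)`), `occAt_eqT`, `inLin_iffT`, `skelOK_linT`
  (`Realises → SkelOK`, nothing else), `treeD_eqT`, `treeSteps_eqT`, `exists_root_eventT`, **`RLin.LatSepT`**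
  (lateral separation on the carrier, tagged occupancy) and `latSeparatedT`.
* §2 **`RLin.lineageReadingsT`**: `LineageReadingsT D.toLinDataT.model C K Kc R g A Bad jlo nup …` from the flow side
  conditions, (i) nonnegativity, (ii′) rooting of bad terms before `jlo`, (iii′) `LatSepT`, **(iv‴) per lineage
  `Realises ∧ PendingAt K` — NOTHING ELSE**, (v″) the factorisation on the tagged label (credits ∕ life cost through
  `Prod.snd`), (vi) the remainder.
* §3 **`RLin.runReadingsFlowT_typed`**: the binder `RunReadingsFlowT` of `exists_irThresholdT_relWeightBound` from
  realised data with the run's own frozen exponents, those readings, and TYPED FLOW FACTS ONLY.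
HONEST RESIDUE OF THE CONTOUR ROUTE after this file: (a) the identification of Bałaban's terms ∕ final live components
with realised histories on the COUNT carrier — `Realises`, `PendingAt` (H3-type; EVERY history admitted: several joins
at one step, equal-class simultaneous births); (b) `LatSepT` (print's merger criterion read contrapositively); (c) the
factorisation (v″) and remainder (vi) — A3a ∕ A3e ∕ A3f, NOT PRINTED as statements; (d) the typed flow facts (BetaPertH
behind them); (e) (B) inside `LowEnvelope` ×2.  `TypeNodup` (R-A) and `RenewAtReach` (F-1(c)) are BOTH gone.

HONEST DEPENDENCY (cell, verbatim): continuum YM on T⁴ ⇐ BetaPertH ∧ nine spine estimates (0/9 proved); BetaPertH ⇐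
(D1) ∧ (D4) ∧ CAP+tail; G-an2-4 gates asym, D1 and NE2/3/4.  This file changes none of it.
-/

open Finset

namespace Summit.QuantumFields.BalabanUV.T4Continuum.SpaceTimePeierls

open Literature.MathematicalPhysics.QuantumFieldTheory.Balaban1983to89
open Literature.MathematicalPhysics.QuantumFieldTheory.Balaban1983to89.B13ScaleTransfer
open Literature.MathematicalPhysics.QuantumFieldTheory.Balaban1983to89.B16SProfile
open T4PersistenceDictionary T4BankedInduction T4PrintedShapeBanking
open T4TaggedShapeBanking (dictWT costT)
open Summit.QuantumFields.BalabanUV.T4Continuum.ZoneTorus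
open Summit.QuantumFields.BalabanUV.T4Continuum.ZoneSkeleton (gmap events_gmap)
open Summit.QuantumFields.BalabanUV.T4Continuum.HistoryZones (levelOf expOf expOf_succ_le dropCtl_expOf)
open Summit.QuantumFields.BalabanUV.T4Continuum.HistoryAdmissible
open Summit.QuantumFields.BalabanUV.T4Continuum.HistoryRealise
open Summit.QuantumFields.BalabanUV.T4Continuum.HistoryBankingLE (ConsistentTLE)
open SpaceTimePeierlsLeaves

noncomputable section

open Classical

/-! ## §1 The tagged lineage data on the COUNT carrier -/

section RootT

variable {d L : ℕ} {s R : ℕ → ℕ}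

/-- **THE ROOT EVENT, tagged**: a realised history has a tagged event of step `rootStep` with nonempty tagged piece.
[folklore] -/
theorem exists_root_eventT :
    ∀ (n : ℕ) {P : PGen (Pt d × Finset (Pt d))} {Z : Finset (Pt d)}, Realises L s R P Z →
      ∃ e ∈ (toGenT n P).events, tstep e = P.rootStep ∧ (pieceOfT L s n P e).Nonempty
  | n, .birth j cls zZ, Z, hRZ => by
      obtain ⟨hzZ, hz, -, -⟩ := hRZ
      refine ⟨(n, ((j, 0, cls) : PEv)), by simp [toGenT], rfl, ?_⟩
      have hpc : pieceOfT L s n (.birth j cls zZ) (n, ((j, 0, cls) : PEv)) = Z := by simp [pieceOfT, hzZ]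
      rw [hpc]
      exact ⟨_, hz⟩
  | n, .renew G h, Z, hRZ => by
      obtain ⟨ZG, hG, -, -, -⟩ := hRZ
      obtain ⟨e, he, hst, hne⟩ := exists_root_eventT (n + 1) hG
      refine ⟨e, ?_, ?_, ?_⟩
      · simp only [toGenT, Gen.events_renew, mem_insert]
        exact Or.inr he
      · simpa only [PGen.rootStep] using hst
      · simpa only [pieceOfT] using hne
  | n, .join X Y sj, Z, hRZ => by
      obtain ⟨ZX, ZY, hX, hY, -, -, -, -, -, -⟩ := hRZ
      by_cases hle : X.rootStep ≤ Y.rootStep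
      · obtain ⟨e, he, hst, hne⟩ := exists_root_eventT (n + 1) hX
        refine ⟨e, ?_, ?_, ?_⟩
        · simp only [toGenT, Gen.events_merge, mem_insert, mem_union]
          exact Or.inr (Or.inl he)
        · simp only [PGen.rootStep, hst]
          exact (min_eq_left hle).symm
        · simp only [pieceOfT]
          split_ifs
          · exact connector_nonempty _
          · exact hne.mono subset_union_left
      · obtain ⟨e, he, hst, hne⟩ := exists_root_eventT (n + 1 + evCount X) hY
        refine ⟨e, ?_, ?_, ?_⟩
        · simp only [toGenT, Gen.events_merge, mem_insert, mem_union]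
          exact Or.inr (Or.inr he)
        · simp only [PGen.rootStep, hst]
          exact (min_eq_right (by omega)).symm
        · simp only [pieceOfT]
          split_ifs
          · exact connector_nonempty _
          · exact hne.mono subset_union_right

end RootT

namespace RLin

variable {d n L Kx K : ℕ} {ℓ : ℕ → ℕ} {ι Λ : Type*} (D : RLin d n L Kx K ℓ ι Λ)

/-- **THE LINEAGE DATA OVER TAGGED LABELS**: events of the lineage `λ` are `(λ, (tag, type))`; the genealogy of `λ` is
the push-forward of the TAGGED label `toGenT 0 (P λ)`; pieces are the tagged pieces `pieceOfT L s 0 (P λ)`. [folklore] -/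
def toLinDataT : LinData d n L Kx K ℓ ι Λ (Λ × (ℕ × PEv)) where
  hN := D.hN
  hℓK := D.hℓK
  T := D.T
  fam := D.fam
  G := fun lam => gmap (Prod.mk lam) (toGenT 0 (D.P lam))
  q := ratio L D.s
  step := fun p => tstep p.2
  piece := fun p => pieceOfT L D.s 0 (D.P p.1) p.2

/-- the class read off a twice-tagged label [folklore] -/
def fatTT : Λ × (ℕ × PEv) → ℕ := fun p => tfat p.2

/-- the terms of the tagged data [folklore] -/
@[simp] theorem toLinDataT_T : D.toLinDataT.T = D.T := rfl

/-- the lineages of the tagged data [folklore] -/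
@[simp] theorem toLinDataT_fam : D.toLinDataT.fam = D.fam := rfl

/-- the genealogies of the tagged data [folklore] -/
theorem toLinDataT_G (lam : Λ) : D.toLinDataT.G lam = gmap (Prod.mk lam) (toGenT 0 (D.P lam)) := rfl

/-- the ratios of the tagged data [folklore] -/
@[simp] theorem toLinDataT_q : D.toLinDataT.q = ratio L D.s := rfl

/-- the tree sum of the profile is that of the tagged label [folklore] -/
theorem treeD_eqT (dC : ℝ) (lam : Λ) (t : ℕ) :
    treeD fatTT D.toLinDataT.step dC (D.toLinDataT.G lam) t = treeD tfat tstep dC (toGenT 0 (D.P lam)) t :=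
  treeD_gmap (Prod.mk lam) (step := tstep) (fat := tfat) (fun _ => rfl) (fun _ => rfl) _ t

/-- the structure-step count is that of the tagged label [folklore] -/
theorem treeSteps_eqT (lam : Λ) (t : ℕ) :
    treeSteps D.toLinDataT.step (D.toLinDataT.G lam) t = treeSteps tstep (toGenT 0 (D.P lam)) t :=
  treeSteps_gmap (Prod.mk lam) (step := tstep) (fun _ => rfl) _ t

variable [DecidableEq Λ]

/-- **THE OCCUPIED SETS ARE THOSE OF THE TAGGED LABEL** (`occAt_gmap`). [folklore] -/
theorem occAt_eqT (lam : Λ) (u : ℕ) :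
    occAt D.toLinDataT.q D.toLinDataT.step D.toLinDataT.piece (D.toLinDataT.G lam) u =
      occAt (ratio L D.s) tstep (pieceOfT L D.s 0 (D.P lam)) (toGenT 0 (D.P lam)) u :=
  occAt_gmap (Prod.mk lam) (step := tstep) (piece := pieceOfT L D.s 0 (D.P lam)) (fun _ => rfl) (fun _ => rfl) _ u

/-- `InLin` read on the carrier, tagged occupancy [folklore] -/
theorem inLin_iffT {lam : Λ} {c : STCellV d n L Kx K ℓ} :
    D.toLinDataT.InLin lam c ↔
      ∃ y ∈ occAt (ratio L D.s) tstep (pieceOfT L D.s 0 (D.P lam)) (toGenT 0 (D.P lam)) c.sc,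
        c.pt = toCell (n * L ^ Kx) (L ^ ℓ c.sc) D.hN y := by
  unfold LinData.InLin
  rw [occAt_eqT]

/-- **`SkelOK` OF A TAGGED LINEAGE FROM `Realises` ALONE** (`skelOK_of_realisesT` + `skelOK_gmap`). [folklore] -/
theorem skelOK_linT (hL : 4 ≤ L) (hdrop : ∀ m, DropCtl D.s m) {R : ℕ → ℕ} {lam : Λ}
    (hRl : Realises L D.s R (D.P lam) (D.Z lam)) :
    SkelOK D.toLinDataT.q D.toLinDataT.step D.toLinDataT.piece fatTT ((127 : ℝ) ^ d + 3) (D.toLinDataT.G lam) :=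
  skelOK_gmap (Prod.mk lam) (step := tstep) (piece := pieceOfT L D.s 0 (D.P lam)) (fat := tfat)
    (fun _ => rfl) (fun _ => rfl) (fun _ => rfl) (skelOK_of_realisesT hL hdrop 0 hRl).1

/-- **LATERAL SEPARATION ON THE CARRIER, tagged occupancy** (print's merger criterion p. 386 read contrapositively):
at every step `u ≤ K`, occupied index points of distinct lineages of one term have distinct, laterally non-adjacent
torus cells. A displayed reading. [folklore] -/
def LatSepT : Prop :=
  ∀ τ ∈ D.T, ∀ lam₁ ∈ D.fam τ, ∀ lam₂ ∈ D.fam τ, lam₁ ≠ lam₂ → ∀ u, u ≤ K →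
    ∀ y₁ ∈ occAt (ratio L D.s) tstep (pieceOfT L D.s 0 (D.P lam₁)) (toGenT 0 (D.P lam₁)) u,
    ∀ y₂ ∈ occAt (ratio L D.s) tstep (pieceOfT L D.s 0 (D.P lam₂)) (toGenT 0 (D.P lam₂)) u,
      toCell (n * L ^ Kx) (L ^ ℓ u) D.hN y₁ ≠ toCell (n * L ^ Kx) (L ^ ℓ u) D.hN y₂ ∧
      ¬ nearT n L Kx (toCell (n * L ^ Kx) (L ^ ℓ u) D.hN y₁) (ℓ u) (toCell (n * L ^ Kx) (L ^ ℓ u) D.hN y₂)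
          (ℓ u) (ℓ u) 1

/-- carrier-level lateral separation is the tagged data's `LatSeparated` [folklore] -/
theorem latSeparatedT (h : D.LatSepT) : D.toLinDataT.LatSeparated := by
  refine ⟨fun τ hτ lam₁ h₁ lam₂ h₂ hne c₁ c₂ hc₁ hc₂ hsc => ?_⟩
  obtain ⟨y₁, hy₁, hp₁⟩ := D.inLin_iffT.1 hc₁
  obtain ⟨y₂, hy₂, hp₂⟩ := D.inLin_iffT.1 hc₂
  have hK : c₁.sc ≤ K := Nat.le_of_lt_succ c₁.1.1.isLt
  rw [← hsc] at hy₂ hp₂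
  obtain ⟨hne', hfar⟩ := h τ (by simpa using hτ) lam₁ (by simpa using h₁) lam₂ (by simpa using h₂) hne c₁.sc hK
    y₁ hy₁ y₂ hy₂
  refine ⟨fun hcc => hne' ?_, ?_⟩
  · rw [← hp₁, ← hp₂, hcc]
  · rw [← hsc, hp₁, hp₂]
    exact hfar

/-! ## §2 The tagged lineage readings on the COUNT carrier -/

/-- **THE TAGGED LINEAGE READINGS ON THE COUNT CARRIER.**  Entropy fields, cover, cell clause and the per-lineage
`ConsistentTLE Prod.snd` ∕ `WF` ∕ reach ∕ `SkelOK` PROVED; displayed: the flow side conditions, nonnegativity, the rooting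
of bad terms before `jlo`, `LatSepT`, `Realises ∧ PendingAt` per lineage — NOTHING ELSE about the histories —, the
factorisation on the tagged label and the remainder. [folklore] -/
theorem lineageReadingsT {C : T4PrintedShapeBanking.Consts} {Kc : ℕ} {R : ℕ → ℕ} {g : ℕ → ℝ} {A : ι → ℝ}
    {Bad : Finset ι} {jlo : ℕ} {nup c₃ : ℝ} {rest : Finset (STCellV d n L Kx K ℓ) → ι → ℝ}
    -- the flow
    (hn : 0 < n) (hL : 4 ≤ L) (hmono : ∀ u, ℓ u ≤ ℓ (u + 1)) (hjump : ∀ u, ℓ (u + 1) ≤ ℓ u + 2)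
    (hqℓ : ∀ u, ratio L D.s u = L ^ (ℓ (u + 1) - ℓ u)) (hdrop : ∀ m, DropCtl D.s m) (hR : ∀ t, 1 ≤ R t)
    (hn₁ : 13 ≤ C.n₁) (hKc : K ≤ Kc)
    -- (i) nonnegative weights; the bad class
    (hnonneg : ∀ τ ∈ D.T, 0 ≤ A τ) (hBad : Bad ⊆ D.T) (hjlo : jlo ≤ K)
    -- (ii′) the old structure
    (hold : ∀ τ ∈ Bad, ∃ lam ∈ D.fam τ, (D.P lam).rootStep ≤ jlo)
    -- (iii′) lateral separation
    (hsep : D.LatSepT)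
    -- (iv‴) realised and pending at the cutoff — nothing else
    (hreal : ∀ τ ∈ D.T, ∀ lam ∈ D.fam τ, Realises L D.s R (D.P lam) (D.Z lam) ∧
      PendingAt L D.s R (D.P lam).lastStep (D.Z lam) K)
    -- (v″) factorisation on the tagged label of the lineage containing the contour
    (hfac : ∀ (𝒦 : Finset (STCellV d n L Kx K ℓ)), ∀ τ ∈ D.T, D.toLinDataT.model.IsContour τ 𝒦 → ∀ lam ∈ D.fam τ,
      (∀ c ∈ 𝒦, D.toLinDataT.InLin lam c) →
        A τ ≤ Real.exp (-(credits (credit C g ∘ Prod.snd) (toGenT 0 (D.P lam)) -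
          lifeCost (dictWT Prod.snd R C.n₁) (costT Prod.snd C Kc R) (toGenT 0 (D.P lam)))) * rest 𝒦 τ)
    -- (vi) the remainder
    (hrest0 : ∀ (𝒦 : Finset (STCellV d n L Kx K ℓ)), ∀ τ ∈ D.T, 0 ≤ rest 𝒦 τ)
    (hrest : ∀ (𝒦 : Finset (STCellV d n L Kx K ℓ)),
      ∑ τ ∈ D.toLinDataT.model.T.filter (fun τ => D.toLinDataT.model.IsContour τ 𝒦), rest 𝒦 τ ≤
        Real.exp c₃ ^ 𝒦.card * nup) :
    LineageReadingsT D.toLinDataT.model C K Kc R g A Bad jlo nup (3 ^ d + L ^ (2 * d) + 1)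
      ((((3 ^ d + L ^ (2 * d) + 1 : ℕ) : ℝ) + 1) ^ 2) (((n * L ^ (Kx - ℓ K)) ^ d : ℕ) : ℝ)
      (8 * 126 ^ d) (126 ^ d) ((127 : ℝ) ^ d + 3) c₃ := by
  -- (iv‴) ⇒ the per-lineage facts on the tagged label
  have hlin : ∀ τ ∈ D.T, ∀ lam ∈ D.fam τ,
      ConsistentTLE Prod.snd C Kc R (toGenT 0 (D.P lam)) ∧ (toGenT 0 (D.P lam)).WF (dictWT Prod.snd R C.n₁) ∧
      K + 1 ≤ (toGenT 0 (D.P lam)).reach (dictWT Prod.snd R C.n₁) ∧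
      SkelOK D.toLinDataT.q D.toLinDataT.step D.toLinDataT.piece fatTT ((127 : ℝ) ^ d + 3) (D.toLinDataT.G lam) := by
    intro τ hτ lam hlam
    obtain ⟨hRl, hPd⟩ := hreal τ hτ lam hlam
    have hlast : (D.P lam).lastStep ≤ K := hPd.1
    exact ⟨consistentTLE_toGenT_of_realises hL hdrop hR C hn₁ hRl (hlast.trans hKc) 0,
      wf_toGenT_of_realises hL hdrop hR hn₁ hRl 0, lt_reach_toGenT_of_pendingAt hL hdrop hR hn₁ hRl hPd 0,
      D.skelOK_linT hL hdrop hRl⟩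
  -- (iii′) ⇒ separation in the space-time cell graph
  have hsep' : D.toLinDataT.Separated :=
    D.toLinDataT.separated_of_lat (fat := fatTT) (dC := (127 : ℝ) ^ d + 3) (by omega) hmono hqℓ
      (fun τ hτ lam hlam => (hlin τ hτ lam hlam).2.2.2) (D.latSeparatedT hsep)
  -- the lineage containing a contour, with its cell bound on the tagged label
  have key : ∀ (τ : ι) (𝒦 : Finset (STCellV d n L Kx K ℓ)), τ ∈ D.T ∧ D.toLinDataT.model.IsContour τ 𝒦 →
      ∃ lam ∈ D.fam τ, (∀ c ∈ 𝒦, D.toLinDataT.InLin lam c) ∧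
        (𝒦.card : ℝ) ≤ 8 * 126 ^ d * treeD tfat tstep ((127 : ℝ) ^ d + 3) (toGenT 0 (D.P lam)) (K + 1) +
          126 ^ d * treeSteps tstep (toGenT 0 (D.P lam)) (K + 1) := by
    intro τ 𝒦 h
    obtain ⟨lam, hlam, hin, hct⟩ := D.toLinDataT.card_contour_le_tree (fat := fatTT) hsep' h.1 h.2 hL rfl (hdrop K)
      le_rfl (by positivity) fun lam hlam => (hlin τ h.1 lam hlam).2.2.2
    refine ⟨lam, hlam, hin, ?_⟩
    rw [D.treeD_eqT, D.treeSteps_eqT] at hct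
    exact hct
  refine
    { deg := fun c => degree_stGraphV_le (by omega) hjump c
      animal := siteAnimalBound_sq (3 ^ d + L ^ (2 * d) + 1)
      anchors := ?_
      nonneg := hnonneg
      cover := D.toLinDataT.contourCover (fat := fatTT) (dC := (127 : ℝ) ^ d + 3) hn (by omega) hmono hqℓ hBad hjlo
        fun τ hτ => ?_
      lineage := ?_ }
  · have h := card_anchorsV_le (d := d) (n := n) (L := L) (Kx := Kx) (K := K) (ℓ := ℓ) (by omega) (D.hℓK K le_rfl)
    exact_mod_cast h
  · -- (ii′) ⇒ (ii): the root event of a lineage rooted before `jlo`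
    obtain ⟨lam, hlam, hroot⟩ := hold τ hτ
    obtain ⟨hRl, -⟩ := hreal τ (hBad hτ) lam hlam
    obtain ⟨e, he, hst, hne⟩ := exists_root_eventT 0 hRl
    refine ⟨lam, hlam, (hlin τ (hBad hτ) lam hlam).2.2.2, (lam, e), ?_, ?_, hne⟩
    · rw [toLinDataT_G, events_gmap]
      exact mem_image_of_mem _ he
    · show tstep e ≤ jlo
      rw [hst]
      exact hroot
  · refine ⟨fun τ 𝒦 => if h : τ ∈ D.T ∧ D.toLinDataT.model.IsContour τ 𝒦 then
        toGenT 0 (D.P (Classical.choose (key τ 𝒦 h))) else Gen.born default 0, rest, fun _ _ => K + 1,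
        fun 𝒦 τ hτ h𝒦 => ?_, hrest0, hrest⟩
    have hgen : (if h : τ ∈ D.T ∧ D.toLinDataT.model.IsContour τ 𝒦 then
        toGenT 0 (D.P (Classical.choose (key τ 𝒦 h))) else Gen.born default 0) =
          toGenT 0 (D.P (Classical.choose (key τ 𝒦 ⟨hτ, h𝒦⟩))) := dif_pos ⟨hτ, h𝒦⟩
    beta_reduce
    rw [hgen]
    obtain ⟨hlam, hin, hcard⟩ := Classical.choose_spec (key τ 𝒦 ⟨hτ, h𝒦⟩)
    obtain ⟨hcons, hwf, hreach, -⟩ := hlin τ hτ _ hlam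
    exact ⟨hcons, hwf, hreach, hcard, hfac 𝒦 τ hτ h𝒦 _ hlam hin⟩

end RLin

/-! ## §3 The binder of the tagged flow end, inhabited along the typed flow -/

namespace RLin

variable {d n L K : ℕ} {ι Λ : Type*} [DecidableEq Λ] {R : ℕ → ℕ}
  (D : RLin d n L K K (levelOf (expOf L R) K) ι Λ)

/-- **`RunReadingsFlowT` FROM THE REALISED DATA, THE READINGS (i) (ii′) (iii′) (iv‴) (v″) (vi) AND TYPED FLOW FACTS
ONLY** — every history admitted.  Levels = `levelOf (expOf L R) K`, torus exponent `K`, `D.s = extExp (expOf L R) K`;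
the two level facts from the interval with monotone couplings and from (2.7) at the size exponent `r` plus the
located smallness of the drop control. [folklore] -/
theorem runReadingsFlowT_typed {C : T4PrintedShapeBanking.Consts} {r : ℕ} {γ β₀ x₀ β' : ℝ} {T : ℕ → Finset ι}
    {X : ℕ → ℝ → ι → ℝ} {Bad : ℕ → ℝ → Finset ι} {xup : ℕ → ℝ → ℝ} {jstar : ℕ → ℕ} {c₃ : ℝ} {t : ℝ}
    {Kc : ℕ} {g : ℕ → ℝ} {rest : Finset (STCellV d n L K K (levelOf (expOf L R) K)) → ι → ℝ}
    (hT : D.T = T K) (hDs : D.s = extExp (expOf L R) K)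
    -- the typed flow facts of the run
    (hI : Step.InInterval γ Kc g) (hγ1 : γ ≤ 1) (hgmono : ∀ u, u < Kc → g u ≤ g (u + 1))
    (h27 : B14.FlowIneq27 g β' β₀ C.p₀ Kc) (h27r : B14.FlowIneq27 g β' β₀ r Kc)
    (h29 : B14FlowStep.FlowIneq29 R g L β' β₀ Kc) (hRj : ∀ u, u ≤ Kc → B14.IsRj L r (g u) (R u))
    (hΘ : ∀ m u, m < u → u ≤ Kc → (1 + (g u) ^ 2 * β' * ((u : ℝ) - m)) ^ β₀ ≤ (L : ℝ) ^ (max (u - m) 2 / 2))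
    (hx1 : ∀ u, u ≤ Kc → 1 ≤ Real.log ((g u) ^ 2)⁻¹) (hxK : x₀ ≤ Real.log ((g Kc) ^ 2)⁻¹)
    -- the remaining hypotheses
    (hn : 0 < n) (hL : 4 ≤ L) (hR : ∀ t, 1 ≤ R t) (hn₁ : 13 ≤ C.n₁) (hKc : K ≤ Kc)
    (hnonneg : ∀ τ ∈ D.T, 0 ≤ X K t τ) (hBad : Bad K t ⊆ D.T) (hjlo : jstar K ≤ K)
    (hold : ∀ τ ∈ Bad K t, ∃ lam ∈ D.fam τ, (D.P lam).rootStep ≤ jstar K)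
    (hsep : D.LatSepT)
    (hreal : ∀ τ ∈ D.T, ∀ lam ∈ D.fam τ, Realises L D.s R (D.P lam) (D.Z lam) ∧
      PendingAt L D.s R (D.P lam).lastStep (D.Z lam) K)
    (hfac : ∀ (𝒦 : Finset (STCellV d n L K K (levelOf (expOf L R) K))), ∀ τ ∈ D.T,
      D.toLinDataT.model.IsContour τ 𝒦 → ∀ lam ∈ D.fam τ, (∀ c ∈ 𝒦, D.toLinDataT.InLin lam c) →
        X K t τ ≤ Real.exp (-(credits (credit C g ∘ Prod.snd) (toGenT 0 (D.P lam)) -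
          lifeCost (dictWT Prod.snd R C.n₁) (costT Prod.snd C Kc R) (toGenT 0 (D.P lam)))) * rest 𝒦 τ)
    (hrest0 : ∀ (𝒦 : Finset (STCellV d n L K K (levelOf (expOf L R) K))), ∀ τ ∈ D.T, 0 ≤ rest 𝒦 τ)
    (hrest : ∀ (𝒦 : Finset (STCellV d n L K K (levelOf (expOf L R) K))),
      ∑ τ ∈ D.toLinDataT.model.T.filter (fun τ => D.toLinDataT.model.IsContour τ 𝒦), rest 𝒦 τ ≤
        Real.exp c₃ ^ 𝒦.card * xup K t) :
    RunReadingsFlowT C L r β₀ x₀ T X Bad xup jstar ((((3 ^ d + L ^ (2 * d) + 1 : ℕ) : ℝ) + 1) ^ 2)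
      (((n * L ^ (K - levelOf (expOf L R) K K)) ^ d : ℕ) : ℝ) (8 * 126 ^ d) (126 ^ d) ((127 : ℝ) ^ d + 3)
      c₃ K t := by
  have hL2 : 2 ≤ L := by omega
  have hsKc : ∀ u, u < Kc → expOf L R (u + 1) ≤ expOf L R u :=
    expOf_succ_le hL2 hRj (fun u hu => (hI u hu).1) (fun u hu => (hI u hu).2.trans hγ1) hgmono
  have hdropKc : DropCtl (expOf L R) Kc := dropCtl_expOf hL2 hI hγ1 hRj h27r hΘ
  have hs : ∀ u, u < K → expOf L R (u + 1) ≤ expOf L R u := fun u hu => hsKc u (lt_of_lt_of_le hu hKc)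
  have hdropK : DropCtl (expOf L R) K := fun i k hik hk => hdropKc i k hik (hk.trans hKc)
  exact ⟨STCellV d n L K K (levelOf (expOf L R) K), inferInstance, inferInstance, D.toLinDataT.model, inferInstance,
    3 ^ d + L ^ (2 * d) + 1, Kc, R, g, β', hT, h27, h29, hRj, hx1, hxK,
    D.lineageReadingsT hn hL (levelOf_mono' hs hdropK) (levelOf_jump hs hdropK)
      (fun u => by rw [hDs]; exact ratio_extExp_eq hs hdropK L u)
      (fun m => by rw [hDs]; exact dropCtl_extExp hdropK m)
      hR hn₁ hKc hnonneg hBad hjlo hold hsep hreal hfac hrest0 hrest⟩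

end RLin

end

end Summit.QuantumFields.BalabanUV.T4Continuum.SpaceTimePeierls
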